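import Summits.HodgeConjecture.HodgeConjecture.Theorems.MarkmanPartnerTransportK3Sq2SquareTransportAlongCorrespondence
import Summits.HodgeConjecture.HodgeConjecture.Theorems.MarkmanPartnerTransportK3Sq2KugaSatakeMixedEndomorphismsHK
import Summits.HodgeConjecture.HodgeConjecture.Theorems.MarkmanPartnerTransportPicardThreeK3SquaresCycleInducedSector

/-!
# Route MarkmanPartnerTransport · support `PartnerTransport` (stmt-HodgeConjecture-19650) ∕ cruxes #4–#5 — the CONVERSE
# transport HC⁴(X) ⇒ HC⁴(S × S) along ANY algebraic correspondence `S → X` non-zero on the period (real-multiplication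
# case; no Kuga–Satake, no Markman), and the iff with `…K3Sq2SquareTransportAlongCorrespondence`

KS-free form of `…K3Sq2KugaSatakeMixedTransportConverse`: the front end of
`hodgeConjectureFor_of_square_of_algebraicCorrespondence` (descent of the given `Φ` to an injective Hodge morphism
`a : T(S)_ℚ → T(X)_ℚ` with a rational algebraic witness, Lefschetz transpose, descent back to `b : T(X)_ℚ → T(S)_ℚ`)
followed by the Schur ∕ subfield argument on the SURFACE side (`u′ := b ∘ a ∈ E(S)`; a route endomorphism of `H²(S)`
restricts to `e ∈ E(S)`; `a ∘ e ∘ b ∈ E(X)` is realised by a `q`-self-adjoint route endomorphism of `H²(X)` —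
`exists_routeEndo_of_mem_endAlgHK` + `hsaX` — hence cycle-induced by HC⁴(X), `exists_corr_eq_of_routeEndo_of_hodgeConjectureForHK`;
subfield trick; `CycleInducedSector.hodgeConjectureFor_square_of_cycleInducedSector`). THEOREMS ONLY; CONDITIONAL on
{Verbitsky–Guan, Charles–Markman} (+ O'Grady for the iff); no sorry, no definition, no named fact; nothing here is
unconditional about HC. Prover seat hodge-nonav-19652-p1 (gen 16), `--supports stmt-HodgeConjecture-19650`.

References: C. Voisin, *Hodge Theory I* Lemma 7.25, Lemma 11.41; Yu. Zarhin, J. reine angew. Math. 341 (1983)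
Thm. 1.5.1; K. O'Grady, Commun. Contemp. Math. 10 (2008) §2–3; F. Charles, E. Markman, Compos. Math. 149 (2013) Thm. 1.1.
-/

set_option linter.dupNamespace false

noncomputable section

namespace Summit.HodgeConjecture.HodgeConjecture.Theorems.MarkmanPartnerTransport.KugaSatakeMixed

open scoped TensorProduct
open CategoryTheory MonoidalCategory Literature.AlgebraicGeometry Literature.AlgebraicGeometry.Motives
open Literature.AlgebraicGeometry.HodgeTheory Literature.AlgebraicTopology.SingularHomology
open Literature.AlgebraicGeometry.Motives.HodgeStructure Literature.AlgebraicGeometry.Hyperkaehler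
open Literature.AlgebraicGeometry.Surfaces
open Summit.HodgeConjecture.HodgeConjecture.Ring2.AbelianAll
open Summit.HodgeConjecture.HodgeConjecture.Theorems.OddPrimeSquares
open Summit.HodgeConjecture.HodgeConjecture.Theorems.NikulinTwinTransport
open Summit.HodgeConjecture.HodgeConjecture.Theorems.MarkmanPartnerTransport.TranscendentalPresentation
open Summit.HodgeConjecture.HodgeConjecture.Theorems.MarkmanPartnerTransport.KugaSatakeSelf
open Summit.HodgeConjecture.HodgeConjecture.Theorems.MarkmanPartnerTransport.KugaSatakePair
open Summit.HodgeConjecture.HodgeConjecture.Theorems.MarkmanPartnerTransport.KugaSatakeHK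
open Summit.HodgeConjecture.HodgeConjecture.Theorems.MarkmanPartnerTransport.CycleInducedSector
open Summit.HodgeConjecture.HodgeConjecture.Theorems.MarkmanPartnerTransport.PartnerLattice

variable {S X : SchemeOver ℂ} {φ : complexBetti X 2 ≃ₗ[ℂ] (K3HilbertIndex → ℂ)} {PX : complexBetti X (2 * 4)}
  {z : K3HilbertIndex → ℂ}

/-- `MarkedK3Sq[X, φ, P, z]`: VERBATIM the route's `let MarkedK3Sq := …` binder (clauses (m1)–(m6)). -/
local notation3 (prettyPrint := false) "MarkedK3Sq[" X ", " φ ", " P ", " z "]" =>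
  (((IsIntegralClass P ∧ ∀ Q : complexBetti X (2 * 4), IsIntegralClass Q → ∃ n : ℤ, Q = n • P) ∧
    (∀ c : complexBetti X 2, IsIntegralClass c ↔ ∃ v : K3HilbertIndex → ℤ, φ c = fun i => (v i : ℂ)) ∧
    (∀ a : complexBetti X 2, cupPowTwo a 4 = ((3 : ℂ) * (k3HilbertForm 2 (φ a) (φ a)) ^ 2) • P) ∧
    (IsOfHodgeType 4 X 2 2 0 (LinearEquiv.symm φ z) ∧
      ∀ τ : complexBetti X 2, IsOfHodgeType 4 X 2 2 0 τ → ∃ t : ℂ, τ = t • LinearEquiv.symm φ z) ∧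
    (∀ c : complexBetti X 2, IsOfHodgeType 4 X 2 1 1 c ↔
      (k3HilbertForm 2 (φ c) z = 0 ∧ k3HilbertForm 2 (φ c) (star z) = 0)) ∧
    (k3HilbertForm 2 z z = 0 ∧ 0 < (k3HilbertForm 2 (star z) z).re)))

/-- `H²[hS]`: the weight-two `ℚ`-Hodge structure on `H²(S(ℂ); ℚ)` of the real Hodge model of the surface `S`. -/
local notation3 "H²[" hS "]" =>
  bettiTwoHodgeStructure hS (BettiUniverse.realHodgeModel exists_isReal_hodgeModel_holds hS)
    (BettiUniverse.realHodgeModel_isHodgeSymmetric exists_isReal_hodgeModel_holds hS)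

/-- `T[hS] = T(S)_ℚ = Hdg¹^⊥ ⊆ H²(S(ℂ); ℚ)`. -/
local notation3 "T[" hS "]" =>
  transcendentalLatticeBetti hS (BettiUniverse.realHodgeModel exists_isReal_hodgeModel_holds hS)
    (BettiUniverse.realHodgeModel_isHodgeSymmetric exists_isReal_hodgeModel_holds hS)

/-- `H²_B[hX]`: the weight-two `ℚ`-Hodge structure on `H²(X(ℂ); ℚ)` of the real Hodge model of the fourfold `X`. -/
local notation3 "H²_B[" hX "]" =>
  bettiTwoHodgeStructureOfModel hX (BettiUniverse.realHodgeModel exists_isReal_hodgeModel_holds hX)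
    (BettiUniverse.realHodgeModel_isHodgeSymmetric exists_isReal_hodgeModel_holds hX)

/-- `Θ : ℂ ⊗_ℚ H²(Y(ℂ); ℚ) → H²(Y(ℂ); ℂ)`. -/
local notation3 "Θ[" Y "]" => ofRatClassBaseChange (Motives.ComplexPoints Y) (2 * 1)

/-- `ι : H²(Y(ℂ); ℚ) → H²(Y(ℂ); ℂ)`, the rational lattice. -/
local notation3 "ι[" Y "]" => ofRatClass (Motives.ComplexPoints Y) (2 * 1)

/-- `Transc[S, y]`: `y` is cup-orthogonal to `N¹(S) = algebraicClasses S 1`. -/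
local notation3 (prettyPrint := false) "Transc[" S ", " y "]" =>
  (∀ d ∈ algebraicClasses S 1, cupProduct (rfl : 2 * 1 + 2 * 1 = 2 * 2) y d = 0)

/-- `BBF[X, φ, y]`: `y` is `q`-orthogonal to `N¹(X) = algebraicClasses X 1`. -/
local notation3 (prettyPrint := false) "BBF[" X ", " φ ", " y "]" =>
  (∀ e : complexBetti X 2, e ∈ algebraicClasses X 1 → k3HilbertForm 2 (φ y) (φ e) = 0)

/-! ### The converse transport along an arbitrary algebraic correspondence -/

set_option maxHeartbeats 400000 in
/-- **HC⁴(X) ⇒ HC⁴(S ⊗ S) along ANY algebraic correspondence `Φ : H²(S) → H²(X)` with `Φ σ ≠ 0`, real-multiplication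
case** (`hsaX`), modulo {Verbitsky–Guan, Charles–Markman}. Proof: module docstring. CONDITIONAL on the two records;
credits nothing to HC. [cite: VoisinHodgeI2002, Lemma 7.25 and Lemma 11.41] [cite: Zarhin1983HodgeGroupsK3, Thm. 1.5.1]
[cite: OGrady2008NumericalK3Square, §3] [cite: CharlesMarkman2013, Thm. 1.1 (§1)] -/
theorem hodgeConjectureFor_square_of_algebraicCorrespondence_SX
    (hV : VerbitskyGuan_cohomology_K3HilbertSquareType) (hCM : CharlesMarkman2013_lefschetzStandard_K3HilbertType)
    (hS : IsSmoothProjective 2 S) {σ : complexBetti S (2 * 1)} (hσ : IsOfHodgeType 2 S (2 * 1) 2 0 σ) (hσ0 : σ ≠ 0)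
    (hline : ∀ c : complexBetti S (2 * 1), IsOfHodgeType 2 S (2 * 1) 2 0 c → ∃ t : ℂ, c = t • σ)
    (hX : IsSmoothProjective 4 X) (hK : IsOfK3HilbertSquareType X) (hM : MarkedK3Sq[X, φ, PX, z])
    (Φ : complexBetti S (2 * 1) →ₗ[ℂ] complexBetti X 2) (hΦ : IsAlgebraicCorrespondence 4 2 X S Φ) (hΦσ : Φ σ ≠ 0)
    (hsaX : ∀ f : complexBetti X 2 →ₗ[ℂ] complexBetti X 2, (∀ y, IsRationalClass y → IsRationalClass (f y)) →
      (∀ (i j : ℕ) y, IsOfHodgeType 4 X 2 i j y → IsOfHodgeType 4 X 2 i j (f y)) →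
      (∀ d : complexBetti X 2, d ∈ algebraicClasses X 1 → f d = 0) → (∀ y : complexBetti X 2, BBF[X, φ, f y]) →
      ∀ y w : complexBetti X 2, k3HilbertForm 2 (φ (f y)) (φ w) = k3HilbertForm 2 (φ y) (φ (f w)))
    (hHCX : HodgeConjectureFor 4 X) : HodgeConjectureFor 4 (S ⊗ S) := by
  classical
  have hX2 : IsSmoothProjective (2 * 2) X := hX
  haveI := BettiUniverse.finite hS (2 * 1); haveI := BettiUniverse.finite hX2 (2 * 1)
  obtain ⟨T, P, ε, hT, htrS, hirr, hK3, -⟩ := exists_isTranscendentalPartBetti_trPart hS hσ hσ0 hline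
  obtain ⟨b, T', Pol, -, hbq, hirr', hK3T', htr', -, hj'⟩ := exists_isTranscendentalPartHK hX2 hM
  haveI := Module.Finite.of_injective T.toSubmodule.subtype T.toSubmodule.injective_subtype
  haveI := Module.Finite.of_injective T'.toSubmodule.subtype T'.toSubmodule.injective_subtype
  have hT' := mem_toSubmodule_iff_of_isTranscendentalPartHK hX2 hbq hj'
  have hσtr := transc_of_twoZero hS hσ
  obtain ⟨x₀, hx₀⟩ := exists_baseChange_eq_of_transc hS T hT hσtr
  have hx₀0 : x₀ ≠ 0 := by rintro rfl; exact hσ0 (by rw [← hx₀, map_zero, map_zero])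
  let ΘS : (ℂ ⊗[ℚ] bettiCohomology S (2 * 1)) ≃ₗ[ℂ] complexBetti S (2 * 1) :=
    LinearEquiv.ofBijective (Θ[S]) ⟨ofRatClassBaseChange_injective _ _, ofRatClassBaseChange_surjective hS (2 * 1)⟩
  have hΘS : ∀ x, ΘS x = Θ[S] x := fun _ => rfl
  have hΘS_symm : ∀ (c : ℂ) (w : bettiCohomology S (2 * 1)), ΘS.symm (c • ι[S] w) = c ⊗ₜ[ℚ] w := by
    intro c w
    apply ΘS.injective
    rw [LinearEquiv.apply_symm_apply, hΘS, ofRatClassBaseChange_tmul]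
  let ΘX : (ℂ ⊗[ℚ] bettiCohomology X (2 * 1)) ≃ₗ[ℂ] complexBetti X (2 * 1) :=
    LinearEquiv.ofBijective (Θ[X]) ⟨ofRatClassBaseChange_injective _ _, ofRatClassBaseChange_surjective hX2 (2 * 1)⟩
  have hΘX : ∀ x, ΘX x = Θ[X] x := fun _ => rfl
  have hΘX_symm : ∀ (c : ℂ) (w : bettiCohomology X (2 * 1)), ΘX.symm (c • ι[X] w) = c ⊗ₜ[ℚ] w := by
    intro c w
    apply ΘX.injective
    rw [LinearEquiv.apply_symm_apply, hΘX, ofRatClassBaseChange_tmul]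
  have hdescSX : ∀ (r : ℂ →ₗ[ℚ] ℚ) {f : complexBetti S (2 * 1) →ₗ[ℂ] complexBetti X 2},
      IsAlgebraicCorrespondence 4 2 X S f → ∃ (a : Hom T.toHodgeStructure T'.toHodgeStructure)
        (fa : complexBetti S (2 * 1) →ₗ[ℂ] complexBetti X 2), IsAlgebraicCorrespondence 4 2 X S fa ∧
        (∀ y, IsRationalClass y → IsRationalClass (fa y)) ∧
        (∀ t : T.toSubmodule, fa (ι[S] (t : bettiCohomology S (2 * 1))) =
          ι[X] ((a.toLinearMap t : T'.toSubmodule) : bettiCohomology X (2 * 1))) ∧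
        ∀ t : T.toSubmodule,
          TensorProduct.lid ℚ _ (r.rTensor _ (ΘX.symm (f (ι[S] (t : bettiCohomology S (2 * 1)))))) =
            ((a.toLinearMap t : T'.toSubmodule) : bettiCohomology X (2 * 1)) := by
    intro r f hf
    obtain ⟨e, hab, γ, hγ, rfl⟩ := IsAlgebraicCorrespondence.exists_eq_corrAction hX hS hf
    suffices hc : ∀ c : ℂ, ∃ (a : Hom T.toHodgeStructure T'.toHodgeStructure)
        (fa : complexBetti S (2 * 1) →ₗ[ℂ] complexBetti X 2), IsAlgebraicCorrespondence 4 2 X S fa ∧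
        (∀ y, IsRationalClass y → IsRationalClass (fa y)) ∧
        (∀ t : T.toSubmodule, fa (ι[S] (t : bettiCohomology S (2 * 1))) =
          ι[X] ((a.toLinearMap t : T'.toSubmodule) : bettiCohomology X (2 * 1))) ∧
        ∀ t : T.toSubmodule, TensorProduct.lid ℚ _ (r.rTensor _ (ΘX.symm
          (c • corrAction complexOrientationFamily hX hS hab γ (ι[S] (t : bettiCohomology S (2 * 1)))))) =
          ((a.toLinearMap t : T'.toSubmodule) : bettiCohomology X (2 * 1)) by
      obtain ⟨a, fa, hfa, hfaQ, hfat, hc1⟩ := hc 1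
      exact ⟨a, fa, hfa, hfaQ, hfat, fun t => by rw [← hc1 t, one_smul]⟩
    have hγ' := (le_of_eq (supportedClasses_eq_span_isRationalClass (hX.tensor_holds hS) (2 * e) e)) hγ
    clear hf hγ
    induction hγ' using Submodule.span_induction with
    | mem γ hγQ =>
      intro c
      obtain ⟨a, ha⟩ := exists_homAlg_of_isRationalClass_SX hS hX2 T hirr hK3 T' htr' hab hγQ.2 hγQ.1
      refine ⟨(r c) • a, ((r c : ℚ) : ℂ) • corrAction complexOrientationFamily hX hS hab γ,
        IsAlgebraicCorrespondence.smul hX hS (isAlgebraicCorrespondence_corrAction_complex hX hS hab (by norm_num) hγQ.2) _,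
        fun y hy => ?_, fun t => ?_, fun t => ?_⟩
      · rw [LinearMap.smul_apply]
        exact (Arapura2006.isRationalClass_corrAction_complex hX hS hab hγQ.1 hy).smul _
      · rw [LinearMap.smul_apply, ha t, Hom.smul_toLinearMap, LinearMap.smul_apply, Submodule.coe_smul,
          Motives.ofRatClass_smul]
      · rw [ha t, hΘX_symm, lid_rTensor_tmul, Hom.smul_toLinearMap, LinearMap.smul_apply, Submodule.coe_smul]
    | zero =>
      intro c
      refine ⟨0, 0, isAlgebraicCorrespondence_zero hX hS (e := 2) rfl (by norm_num), fun y _ => ?_, fun t => ?_,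
        fun t => ?_⟩
      · rw [LinearMap.zero_apply]; exact IsRationalClass.zero
      · rw [LinearMap.zero_apply, Hom.zero_toLinearMap, LinearMap.zero_apply, Submodule.coe_zero, map_zero]
      · rw [map_zero, LinearMap.zero_apply, smul_zero, map_zero, map_zero, map_zero, Hom.zero_toLinearMap,
          LinearMap.zero_apply, Submodule.coe_zero]
    | add γ γ' _ _ h₁ h₂ =>
      intro c
      obtain ⟨a, fa, hfa, hfaQ, hfat, hat⟩ := h₁ c
      obtain ⟨a', fa', hfa', hfaQ', hfat', hat'⟩ := h₂ c
      refine ⟨a + a', fa + fa', IsAlgebraicCorrespondence.add hX hS hfa hfa', fun y hy => ?_, fun t => ?_, fun t => ?_⟩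
      · rw [LinearMap.add_apply]; exact (hfaQ y hy).add (hfaQ' y hy)
      · rw [LinearMap.add_apply, hfat, hfat', Hom.add_toLinearMap, LinearMap.add_apply, Submodule.coe_add, map_add]
      · rw [map_add, LinearMap.add_apply, smul_add, map_add, map_add, map_add, hat, hat', Hom.add_toLinearMap,
          LinearMap.add_apply, Submodule.coe_add]
    | smul c' γ _ h₁ =>
      intro c
      obtain ⟨a, fa, hfa, hfaQ, hfat, hat⟩ := h₁ (c * c')
      refine ⟨a, fa, hfa, hfaQ, hfat, fun t => ?_⟩
      rw [(corrAction complexOrientationFamily hX hS hab).map_smul, LinearMap.smul_apply, smul_smul]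
      exact hat t
  have hzero_orS : ∃ t₀ : T.toSubmodule, Φ (ι[S] (t₀ : bettiCohomology S (2 * 1))) ≠ 0 := by
    by_contra hall
    push Not at hall
    have hzero : ∀ x : ℂ ⊗[ℚ] T.toSubmodule, Φ (Θ[S] (T.toSubmodule.subtype.baseChange ℂ x)) = 0 := by
      intro x
      induction x using TensorProduct.induction_on with
      | zero => rw [map_zero, map_zero, map_zero]
      | tmul c t =>
        rw [LinearMap.baseChange_tmul, Submodule.subtype_apply, ofRatClassBaseChange_tmul, map_smul, hall t, smul_zero]
      | add x y hx hy => rw [map_add, map_add, map_add, hx, hy, add_zero]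
    exact hΦσ (by rw [← hx₀]; exact hzero x₀)
  obtain ⟨s₀, hs₀⟩ := hzero_orS
  have hξS : ΘX.symm (Φ (ι[S] (s₀ : bettiCohomology S (2 * 1)))) ≠ 0 := fun h0 =>
    hs₀ (by simpa only [LinearEquiv.apply_symm_apply, map_zero] using congrArg ΘX h0)
  obtain ⟨rS, hrS⟩ := exists_rat_retraction_ne_zero hξS
  obtain ⟨gT, f₁, hf₁, hf₁Q, hgT, hgr⟩ := hdescSX rS hΦ
  have hgT0 : gT.toLinearMap ≠ 0 := fun h0 => hrS (by rw [hgr, h0, LinearMap.zero_apply, Submodule.coe_zero])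
  have hginj : Function.Injective gT.toLinearMap := Hom.injective_of_ne_zero_of_isIrreducible hirr gT hgT0
  have hf₁σ0 : f₁ σ ≠ 0 := by
    rw [← hx₀, apply_baseChange_eq_SX (fun t => (hgT t).symm)]
    exact fun h0 => hx₀0 (baseChange_injective_of_injective hginj
      (baseChange_injective_of_injective T'.toSubmodule.injective_subtype
        (ofRatClassBaseChange_injective _ _ (by rw [h0, map_zero, map_zero, map_zero]))))
  obtain ⟨Ψ₁, hΨ₁⟩ := exists_ratLinear_ofRatClass_eq₂ (S' := X) f₁ hf₁Q
  obtain ⟨R, hRid, -, hne⟩ := exists_lefschetzTranspose_toSurface hS hX (by norm_num : 2 ≤ 4) hX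
    (isAlgebraicCorrespondence_id hX (a := 2 * 1) (by norm_num)) hf₁
  have hR : IsAlgebraicCorrespondence 2 4 S X R := by simpa only [LinearMap.comp_id] using hRid
  have hRσ : (R ∘ₗ f₁) σ ≠ 0 :=
    hne σ (isOfHodgeType_two_zero_of_isAlgebraicCorrespondence hX hS hf₁ hσ) hf₁σ0 (apply_conjClass_SX hS hX2 hΨ₁ σ)
  have hzero_or : ∃ t₀ : T.toSubmodule, R (f₁ (ι[S] (t₀ : bettiCohomology S (2 * 1)))) ≠ 0 := by
    by_contra hall
    push Not at hall
    have hzero : ∀ x : ℂ ⊗[ℚ] T.toSubmodule, R (f₁ (Θ[S] (T.toSubmodule.subtype.baseChange ℂ x))) = 0 := by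
      intro x
      induction x using TensorProduct.induction_on with
      | zero => rw [map_zero, map_zero, map_zero, map_zero]
      | tmul c t =>
        rw [LinearMap.baseChange_tmul, Submodule.subtype_apply, ofRatClassBaseChange_tmul, map_smul, map_smul, hall t,
          smul_zero]
      | add x y hx hy => rw [map_add, map_add, map_add, map_add, hx, hy, add_zero]
    exact hRσ (by rw [LinearMap.comp_apply, ← hx₀]; exact hzero x₀)
  obtain ⟨t₀, ht₀⟩ := hzero_or
  let Rs : Submodule ℚ (Module.End ℚ T.toSubmodule) :=
    { carrier := {a | a ∈ T.toHodgeStructure.endAlg ∧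
        ∃ f : complexBetti S (2 * 1) →ₗ[ℂ] complexBetti S (2 * 1), IsAlgebraicCorrespondence 2 2 S S f ∧
          ∀ t : T.toSubmodule, f (ι[S] (t : bettiCohomology S (2 * 1))) =
            ι[S] ((a t : T.toSubmodule) : bettiCohomology S (2 * 1))}
      add_mem' := by
        rintro a a' ⟨haE, f, hf, hfa⟩ ⟨hbE, f', hf', hfb⟩
        refine ⟨add_mem haE hbE, f + f', IsAlgebraicCorrespondence.add hS hS hf hf', fun t => ?_⟩
        rw [LinearMap.add_apply, hfa, hfb, LinearMap.add_apply, Submodule.coe_add, map_add]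
      zero_mem' := by
        refine ⟨zero_mem _, 0, isAlgebraicCorrespondence_zero hS hS (e := 2) rfl (by norm_num), fun t => ?_⟩
        rw [LinearMap.zero_apply, LinearMap.zero_apply, Submodule.coe_zero, map_zero]
      smul_mem' := by
        rintro c a ⟨haE, f, hf, hfa⟩
        refine ⟨Subalgebra.smul_mem _ haE c, (c : ℂ) • f, IsAlgebraicCorrespondence.smul hS hS hf _, fun t => ?_⟩
        rw [LinearMap.smul_apply, hfa, LinearMap.smul_apply, Submodule.coe_smul, Motives.ofRatClass_smul] }
  have hRsE : ∀ a ∈ Rs, a ∈ T.toHodgeStructure.endAlg := fun a ha => ha.1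
  have hRsmul : ∀ a ∈ Rs, ∀ a' ∈ Rs, a * a' ∈ Rs := by
    rintro a ⟨haE, f, hf, hfa⟩ a' ⟨hbE, f', hf', hfb⟩
    refine ⟨mul_mem haE hbE, f ∘ₗ f', IsAlgebraicCorrespondence.comp hS hS hS hf' hf (by norm_num), fun t => ?_⟩
    rw [LinearMap.comp_apply, hfb, hfa, Module.End.mul_apply]
  have hdescX : ∀ (r : ℂ →ₗ[ℚ] ℚ) {f : complexBetti X 2 →ₗ[ℂ] complexBetti S (2 * 1)},
      IsAlgebraicCorrespondence 2 4 S X f → ∃ (a : Hom T'.toHodgeStructure T.toHodgeStructure)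
        (fa : complexBetti X 2 →ₗ[ℂ] complexBetti S (2 * 1)), IsAlgebraicCorrespondence 2 4 S X fa ∧
        (∀ t : T'.toSubmodule, fa (ι[X] (t : bettiCohomology X (2 * 1))) =
          ι[S] ((a.toLinearMap t : T.toSubmodule) : bettiCohomology S (2 * 1))) ∧
        ∀ t : T'.toSubmodule,
          TensorProduct.lid ℚ _ (r.rTensor _ (ΘS.symm (f (ι[X] (t : bettiCohomology X (2 * 1)))))) =
            ((a.toLinearMap t : T.toSubmodule) : bettiCohomology S (2 * 1)) := by
    intro r f hf
    obtain ⟨e, hab, γ, hγ, rfl⟩ := IsAlgebraicCorrespondence.exists_eq_corrAction hS hX hf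
    suffices hc : ∀ c : ℂ, ∃ (a : Hom T'.toHodgeStructure T.toHodgeStructure)
        (fa : complexBetti X 2 →ₗ[ℂ] complexBetti S (2 * 1)), IsAlgebraicCorrespondence 2 4 S X fa ∧
        (∀ t : T'.toSubmodule, fa (ι[X] (t : bettiCohomology X (2 * 1))) =
          ι[S] ((a.toLinearMap t : T.toSubmodule) : bettiCohomology S (2 * 1))) ∧
        ∀ t : T'.toSubmodule, TensorProduct.lid ℚ _ (r.rTensor _ (ΘS.symm
          (c • corrAction complexOrientationFamily hS hX hab γ (ι[X] (t : bettiCohomology X (2 * 1)))))) =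
          ((a.toLinearMap t : T.toSubmodule) : bettiCohomology S (2 * 1)) by
      obtain ⟨a, fa, hfa, hfat, hc1⟩ := hc 1
      exact ⟨a, fa, hfa, hfat, fun t => by rw [← hc1 t, one_smul]⟩
    have hγ' := (le_of_eq (supportedClasses_eq_span_isRationalClass (hS.tensor_holds hX) (2 * e) e)) hγ
    clear hf hγ
    induction hγ' using Submodule.span_induction with
    | mem γ hγQ =>
      intro c
      obtain ⟨a, ha⟩ := exists_homAlg_of_isRationalClass_XS hS hX2 T' hirr' hK3T' T htrS hab hγQ.2 hγQ.1
      refine ⟨(r c) • a, ((r c : ℚ) : ℂ) • corrAction complexOrientationFamily hS hX hab γ,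
        IsAlgebraicCorrespondence.smul hS hX (isAlgebraicCorrespondence_corrAction_complex hS hX hab (by norm_num) hγQ.2) _,
        fun t => ?_, fun t => ?_⟩
      · rw [LinearMap.smul_apply, ha t, Hom.smul_toLinearMap, LinearMap.smul_apply, Submodule.coe_smul,
          Motives.ofRatClass_smul]
      · rw [ha t, hΘS_symm, lid_rTensor_tmul, Hom.smul_toLinearMap, LinearMap.smul_apply, Submodule.coe_smul]
    | zero =>
      intro c
      refine ⟨0, 0, isAlgebraicCorrespondence_zero hS hX (e := 4) rfl (by norm_num), fun t => ?_, fun t => ?_⟩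
      · rw [LinearMap.zero_apply, Hom.zero_toLinearMap, LinearMap.zero_apply, Submodule.coe_zero, map_zero]
      · rw [map_zero, LinearMap.zero_apply, smul_zero, map_zero, map_zero, map_zero, Hom.zero_toLinearMap,
          LinearMap.zero_apply, Submodule.coe_zero]
    | add γ γ' _ _ h₁ h₂ =>
      intro c
      obtain ⟨a, fa, hfa, hfat, hat⟩ := h₁ c
      obtain ⟨a', fa', hfa', hfat', hat'⟩ := h₂ c
      refine ⟨a + a', fa + fa', IsAlgebraicCorrespondence.add hS hX hfa hfa', fun t => ?_, fun t => ?_⟩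
      · rw [LinearMap.add_apply, hfat, hfat', Hom.add_toLinearMap, LinearMap.add_apply, Submodule.coe_add, map_add]
      · rw [map_add, LinearMap.add_apply, smul_add, map_add, map_add, map_add, hat, hat', Hom.add_toLinearMap,
          LinearMap.add_apply, Submodule.coe_add]
    | smul c' γ _ h₁ =>
      intro c
      obtain ⟨a, fa, hfa, hfat, hat⟩ := h₁ (c * c')
      refine ⟨a, fa, hfa, hfat, fun t => ?_⟩
      rw [(corrAction complexOrientationFamily hS hX hab).map_smul, LinearMap.smul_apply, smul_smul]
      exact hat t
  have hξ : ΘS.symm (R (ι[X] ((gT.toLinearMap t₀ : T'.toSubmodule) : bettiCohomology X (2 * 1)))) ≠ 0 := fun h0 =>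
    ht₀ (by rw [hgT]; simpa only [LinearEquiv.apply_symm_apply, map_zero] using congrArg ΘS h0)
  obtain ⟨r, hr⟩ := exists_rat_retraction_ne_zero hξ
  obtain ⟨bT, fb, hfb, hfbt, hbr⟩ := hdescX r hR
  have hbT0 : bT.toLinearMap ≠ 0 := fun h0 => hr (by rw [hbr, h0, LinearMap.zero_apply, Submodule.coe_zero])
  have hbinj : Function.Injective bT.toLinearMap := Hom.injective_of_ne_zero_of_isIrreducible hirr' bT hbT0
  -- `u' = bT ∘ g_T ∈ E(S)`, cycle-induced (`fb ∘ Φ`) and injective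
  set u : Hom T.toHodgeStructure T.toHodgeStructure := bT.comp gT with hu
  have huR : u.toLinearMap ∈ Rs := by
    refine ⟨Hom.toLinearMap_mem_endAlg u, fb ∘ₗ f₁, IsAlgebraicCorrespondence.comp hS hX hS hf₁ hfb (by norm_num),
      fun t => ?_⟩
    rw [LinearMap.comp_apply, hgT, hfbt]
    rfl
  have huinj : Function.Injective u.toLinearMap := hbinj.comp hginj
  obtain ⟨hFieldS, -⟩ := Zarhin1983_endAlg_isField_holds T.toHodgeStructure hirr hK3
  -- the cycle-induced sector clause of `S`
  refine hodgeConjectureFor_square_of_cycleInducedSector complexOrientationFamily hS ?_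
  intro fS hf1 hf2 hf3 hf4
  obtain ⟨eS, heS⟩ := exists_hom_transcendental hS T hT fS hf1 hf2 hf4
  -- `v = g_T ∘ e_S ∘ bT ∈ E(X)` is realised by a self-adjoint route endomorphism, cycle-induced by HC⁴(X)
  obtain ⟨Q, hQ1, hQ2, hQ3, hQ4, hQt⟩ := exists_routeEndo_of_mem_endAlgHK hX2 hM htr' hT'
    (Hom.toLinearMap_mem_endAlg (gT.comp (eS.comp bT)))
  obtain ⟨F, hF, hFQ⟩ := exists_corr_eq_of_routeEndo_of_hodgeConjectureForHK hV hCM hX hK hM hHCX Q hQ1 hQ2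
    (hsaX Q hQ1 hQ2 hQ3 hQ4)
  -- `c' = bT ∘ v ∘ g_T = u ∘ e_S ∘ u` is cycle-induced (`fb ∘ F ∘ Φ`)
  have hcR : (u.comp (eS.comp u)).toLinearMap ∈ Rs := by
    refine ⟨Hom.toLinearMap_mem_endAlg _, fb ∘ₗ (F ∘ₗ f₁),
      IsAlgebraicCorrespondence.comp hS hX hS (IsAlgebraicCorrespondence.comp hX hX hS hf₁ hF (by norm_num)) hfb
        (by norm_num), fun t => ?_⟩
    rw [LinearMap.comp_apply, LinearMap.comp_apply, hgT, hFQ, hQt, hfbt]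
    rfl
  have hcomm : u.toLinearMap * eS.toLinearMap = eS.toLinearMap * u.toLinearMap := by
    have h := hFieldS.mul_comm ⟨u.toLinearMap, Hom.toLinearMap_mem_endAlg u⟩ ⟨eS.toLinearMap, Hom.toLinearMap_mem_endAlg eS⟩
    exact congrArg Subtype.val h
  have hrel : (u.toLinearMap * u.toLinearMap) * eS.toLinearMap = (u.comp (eS.comp u)).toLinearMap := by
    rw [mul_assoc, hcomm, ← mul_assoc]
    rfl
  -- the subfield trick: `e_S ∈ Rs`
  have heR : eS.toLinearMap ∈ Rs := by
    by_cases hf0 : eS.toLinearMap = 0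
    · rw [hf0]; exact Rs.zero_mem
    · have hfinj : Function.Injective eS.toLinearMap := Hom.injective_of_ne_zero_of_isIrreducible hirr eS hf0
      have hc0 : (u.comp (eS.comp u)).toLinearMap ≠ 0 := by
        intro h0
        have hinj3 : Function.Injective (u.comp (eS.comp u)).toLinearMap := huinj.comp (hfinj.comp huinj)
        obtain ⟨t, ht⟩ := (Submodule.ne_bot_iff _).1 (Submodule.nontrivial_iff_ne_bot.1 hirr.1)
        exact ht.2 (congrArg Subtype.val (hinj3 (a₁ := ⟨t, ht.1⟩) (a₂ := 0) (by rw [h0, map_zero, LinearMap.zero_apply])))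
      exact mem_of_mul_eq_of_isField hFieldS Rs hRsE hRsmul hcR (hRsmul _ huR _ huR) (Hom.toLinearMap_mem_endAlg eS)
        hc0 hrel
  obtain ⟨-, W, hW, hWt⟩ := heR
  -- `W = [γ]_*`, `N¹`-stable, `= f_S` on `T(S)_ℂ`
  obtain ⟨e, hab, γ, hγ, hWγ⟩ := IsAlgebraicCorrespondence.exists_eq_corrAction hS hS hW
  obtain rfl : e = 2 := by omega
  refine ⟨W, fun d hd => ?_, ⟨γ, hγ, fun y => by rw [hWγ]; rfl⟩, fun y hy => ?_⟩
  · rw [← map_hodgeClasses_baseChange_eq_algebraicClasses hS] at hd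
    obtain ⟨v, hv, rfl⟩ := hd
    obtain ⟨v', rfl⟩ := hv
    induction v' using TensorProduct.induction_on with
    | zero => rw [map_zero, map_zero, map_zero]; exact Submodule.zero_mem _
    | tmul c n =>
      rw [LinearMap.baseChange_tmul, Submodule.subtype_apply, ofRatClassBaseChange_tmul, map_smul, hWγ]
      exact Submodule.smul_mem _ c (corrAction_ofRatClass_mem_algebraicClasses hS hab hγ n.2)
    | add x y hx hy => rw [map_add, map_add, map_add]; exact Submodule.add_mem _ hx hy
  · obtain ⟨x, rfl⟩ := exists_baseChange_eq_of_transc hS T hT hy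
    clear hy
    induction x using TensorProduct.induction_on with
    | zero => rw [map_zero, map_zero, map_zero, map_zero]
    | tmul c t =>
      rw [LinearMap.baseChange_tmul, Submodule.subtype_apply, ofRatClassBaseChange_tmul, map_smul, map_smul, hWt t, heS t]
    | add x y hx hy => rw [map_add, map_add, map_add, map_add, hx, hy]

/-- **HC⁴(X) ⟺ HC⁴(S ⊗ S) along ANY algebraic correspondence `Φ : H²(S) → H²(X)` with `Φ σ ≠ 0`, real-multiplication
case**, modulo {Verbitsky–Guan, O'Grady, Charles–Markman} — `hodgeConjectureFor_square_of_algebraicCorrespondence_SX`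
and `hodgeConjectureFor_of_square_of_algebraicCorrespondence`. CONDITIONAL on the three records; credits nothing to HC.
[cite: VoisinHodgeI2002, Lemma 11.41] [cite: Zarhin1983HodgeGroupsK3, Thm. 1.5.1] [cite: CharlesMarkman2013, Thm. 1.1 (§1)] -/
theorem hodgeConjectureFor_iff_square_of_algebraicCorrespondence
    (hV : VerbitskyGuan_cohomology_K3HilbertSquareType) (hO : OGrady2008_dualBBFClass_algebraic)
    (hCM : CharlesMarkman2013_lefschetzStandard_K3HilbertType) (hS : IsSmoothProjective 2 S) {σ : complexBetti S (2 * 1)}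
    (hσ : IsOfHodgeType 2 S (2 * 1) 2 0 σ) (hσ0 : σ ≠ 0)
    (hline : ∀ c : complexBetti S (2 * 1), IsOfHodgeType 2 S (2 * 1) 2 0 c → ∃ t : ℂ, c = t • σ)
    (hX : IsSmoothProjective 4 X) (hK : IsOfK3HilbertSquareType X) (hM : MarkedK3Sq[X, φ, PX, z])
    (Φ : complexBetti S (2 * 1) →ₗ[ℂ] complexBetti X 2) (hΦ : IsAlgebraicCorrespondence 4 2 X S Φ) (hΦσ : Φ σ ≠ 0)
    (hsaX : ∀ f : complexBetti X 2 →ₗ[ℂ] complexBetti X 2, (∀ y, IsRationalClass y → IsRationalClass (f y)) →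
      (∀ (i j : ℕ) y, IsOfHodgeType 4 X 2 i j y → IsOfHodgeType 4 X 2 i j (f y)) →
      (∀ d : complexBetti X 2, d ∈ algebraicClasses X 1 → f d = 0) → (∀ y : complexBetti X 2, BBF[X, φ, f y]) →
      ∀ y w : complexBetti X 2, k3HilbertForm 2 (φ (f y)) (φ w) = k3HilbertForm 2 (φ y) (φ (f w))) :
    HodgeConjectureFor 4 X ↔ HodgeConjectureFor 4 (S ⊗ S) :=
  ⟨hodgeConjectureFor_square_of_algebraicCorrespondence_SX hV hCM hS hσ hσ0 hline hX hK hM Φ hΦ hΦσ hsaX,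
    hodgeConjectureFor_of_square_of_algebraicCorrespondence hV hO hCM hS hσ hσ0 hline hX hK hM Φ hΦ hΦσ⟩

end Summit.HodgeConjecture.HodgeConjecture.Theorems.MarkmanPartnerTransport.KugaSatakeMixed

end
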